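import Summits.CriticalPhenomena.CardyFormulaZ2.Theorems.HalfPlaneMarkDensityLaw.Negative.MarkEvents

/-!
# `HalfPlaneMarkDensityLaw` (crux stmt-CriticalPhenomena-5661), line `Sketch`, three-arc self-duality:
# stub `stub_threeArc_selfDual_of` (T2') — T1 and W2 give T2

Glue (short algebra of limits).  For a joint subsequential limit `G` of the collinear half-plane
crossing function along a strictly increasing `θ` and a chamber point `a < b < c`:
* (T1) at `(a,b,c)` gives a limit `L` of `y ↦ G(a,b,c,y)` at `+∞` which is also the wired limit
  `lim_M G(−M, −(c−b), 1/M, b−a)`; uniqueness of limits in `ℝ` (the filter `atTop` on `ℝ` is `NeBot`)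
  identifies `L = L₁`;
* (T1) at the complementary split point `(a, a+(c−b), c)` (a chamber point: `a < a+(c−b)` iff `b < c`,
  `a+(c−b) < c` iff `a < b`) gives `L' = L₂` and the wired limit with marks
  `c − (a+(c−b)) = b − a`, `(a+(c−b)) − a = c − b`, i.e. `lim_M G(−M, −(b−a), 1/M, c−b) = L₂`;
* (W2) at `σ := c − b > 0`, `x := b − a > 0`, `W₁ := L₁`, `W₂ := L₂` gives `L₁ + L₂ = 1`.
-/

noncomputable section

namespace Summit.CriticalPhenomena.CardyFormulaZ2.Cruxes.HalfPlaneMarkDensityLaw.SketchLine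

open Literature.Probability.Percolation Literature.Probability.LatticeModels
open MeasureTheory Filter Set
open scoped Topology
open Summit.CriticalPhenomena.CardyFormulaZ2.Theorems.HalfPlaneMarkDensityLaw.Negative

namespace WiredDual

/-- STUB T2' (glue): T1 and W2 give T2 — **`G₃(a,b,c) + G₃(a, a+c−b, c) = 1`**: by (T1) and
uniqueness of limits the three-arc limits `L₁`, `L₂` at the split points `b` and `a + (c − b)` of
`[a,c]` are the wired limits `W_G(c−b, b−a)` and `W_G(b−a, c−b)`, which sum to `1` by (W2). [folklore] -/
theorem stub_threeArc_selfDual_of :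
    (∀ {θ : ℕ → ℕ} {G : ℝ → ℝ → ℝ → ℝ → ℝ},
      (∀ a b c y : ℝ, a < b → b < c → c < y →
        Tendsto (fun n ↦ μ.real (openCrossing halfPlane (arcA a b (θ n))
          (rowIcc ⌊c * (θ n : ℕ)⌋ ⌊y * (θ n : ℕ)⌋))) atTop (𝓝 (G a b c y))) →
      StrictMono θ → ∀ a b c : ℝ, a < b → b < c → ∃ L : ℝ,
        Tendsto (fun y : ℝ ↦ G a b c y) atTop (𝓝 L) ∧
        Tendsto (fun M : ℕ ↦ G (-(M : ℝ)) (-(c - b)) ((M : ℝ)⁻¹) (b - a)) atTop (𝓝 L)) →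
    (∀ {θ : ℕ → ℕ} {G : ℝ → ℝ → ℝ → ℝ → ℝ}, (∀ a b c y : ℝ, a < b → b < c → c < y → Tendsto (fun n ↦ μ.real (openCrossing halfPlane (arcA a b (θ n)) (rowIcc ⌊c * (θ n : ℕ)⌋ ⌊y * (θ n : ℕ)⌋))) atTop (𝓝 (G a b c y))) → StrictMono θ → ∀ σ x : ℝ, 0 < σ → 0 < x → ∀ W₁ W₂ : ℝ, Tendsto (fun M : ℕ ↦ G (-(M : ℝ)) (-σ) ((M : ℝ)⁻¹) x) atTop (𝓝 W₁) → Tendsto (fun M : ℕ ↦ G (-(M : ℝ)) (-x) ((M : ℝ)⁻¹) σ) atTop (𝓝 W₂) → W₁ + W₂ = 1) →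
    ∀ {θ : ℕ → ℕ} {G : ℝ → ℝ → ℝ → ℝ → ℝ},
      (∀ a b c y : ℝ, a < b → b < c → c < y →
        Tendsto (fun n ↦ μ.real (openCrossing halfPlane (arcA a b (θ n))
          (rowIcc ⌊c * (θ n : ℕ)⌋ ⌊y * (θ n : ℕ)⌋))) atTop (𝓝 (G a b c y))) →
      StrictMono θ → ∀ a b c : ℝ, a < b → b < c → ∀ L₁ L₂ : ℝ,
        Tendsto (fun y : ℝ ↦ G a b c y) atTop (𝓝 L₁) →
        Tendsto (fun y : ℝ ↦ G a (a + (c - b)) c y) atTop (𝓝 L₂) → L₁ + L₂ = 1 := by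
  intro hT1 hW2 θ G hG hθ a b c hab hbc L₁ L₂ h₁ h₂
  -- (T1) at `(a, b, c)`: the three-arc limit is `L₁`, and it is the wired limit `W_G(c−b, b−a)`
  obtain ⟨L, hL, hM⟩ := hT1 hG hθ a b c hab hbc
  have e₁ : L = L₁ := tendsto_nhds_unique hL h₁
  subst e₁
  -- (T1) at the complementary split point `(a, a + (c − b), c)`, a chamber point
  have hab' : a < a + (c - b) := by linarith
  have hbc' : a + (c - b) < c := by linarith
  obtain ⟨L', hL', hM'⟩ := hT1 hG hθ a (a + (c - b)) c hab' hbc'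
  have e₂ : L' = L₂ := tendsto_nhds_unique hL' h₂
  subst e₂
  -- straighten the marks: `c − (a + (c − b)) = b − a`, `(a + (c − b)) − a = c − b`
  have e₃ : c - (a + (c - b)) = b - a := by ring
  have e₄ : a + (c - b) - a = c - b := by ring
  have hM'' : Tendsto (fun M : ℕ ↦ G (-(M : ℝ)) (-(b - a)) ((M : ℝ)⁻¹) (c - b)) atTop (𝓝 L') := by
    simpa only [e₃, e₄] using hM'
  -- (W2) at `σ := c − b`, `x := b − a`
  exact hW2 hG hθ (c - b) (b - a) (sub_pos.mpr hbc) (sub_pos.mpr hab) L L' hM hM''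

end WiredDual

end Summit.CriticalPhenomena.CardyFormulaZ2.Cruxes.HalfPlaneMarkDensityLaw.SketchLine
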